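import Literature.Computability.MetaComplexity.BoundedArithRelabel
import Literature.Computability.MetaComplexity.BoundedArithDefinability
import Literature.ModelTheory.UniversalTheories.HerbrandSaturation
import HarnessLib

/-!
# Buss's classes are stable under `toFormula`; bounded formulas as definable predicates

Trunk: CplxMeta (G14), topic `Literature/Computability/MetaComplexity` (companion of
`BoundedArithRelabel.lean`).  Mathlib's `BoundedFormula.toFormula` turns the in-context (bound)
variables `Fin n` of a bounded formula into free variables.  We show that the bounded
quantifiers commute with it (`toFormula_ballLE`, `toFormula_bexLE`, `toFormula_ballLELen`,
`toFormula_bexLELen`) and that the classes of sharply bounded, `Σᵇᵢ` and `Πᵇᵢ` formulas are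
stable under it (`IsSharplyBounded.toFormula`, `IsSigmab.toFormula`, `IsPib.toFormula`), as
asserted in Buss 1986, §2.1 (the classes are syntactic and closed under renaming of variables).
Consequently a `Σᵇᵢ` (`Πᵇᵢ`) formula `θ` with in-context variables `Fin n` and no parameters
defines, in any structure `M`, a `Σᵇᵢ`- (`Πᵇᵢ`-) definable `n`-ary predicate in the sense of
`BoundedArithDefinability` (`IsSigmab.isSigmabDef_realize`, `IsPib.isPibDef_realize`): this is
the bridge by which the function symbols `χ_θ`, `μ_θ` of the universal extension of `T₂ⁱ`
(interpreted through `θ.Realize`) receive their definability certificates.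

## References

* S. R. Buss, *Bounded Arithmetic*, Bibliopolis 1986, §2.1.
-/

namespace Literature.Computability.MetaComplexity

open FirstOrder FirstOrder.Language FirstOrder.Language.BoundedFormula

/-! ## `toFormula` commutes with the connectives and the bounded quantifiers -/

section General

variable {L : Language} {α : Type} {n : ℕ}

/-- The variable map used by `toFormula` under a binder. [folklore] -/
abbrev toFormulaAux (α : Type) (n : ℕ) : α ⊕ Fin (n + 1) → (α ⊕ Fin n) ⊕ Fin 1 :=
  Sum.elim (Sum.inl ∘ Sum.inl) (Sum.map Sum.inr id ∘ finSumFinEquiv.symm)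

/-- `toFormula` of an implication. [folklore] -/
theorem toFormula_imp (φ ψ : L.BoundedFormula α n) :
    (φ.imp ψ).toFormula = φ.toFormula.imp ψ.toFormula := rfl

/-- `toFormula` of `falsum`. [folklore] -/
theorem toFormula_falsum : (falsum : L.BoundedFormula α n).toFormula = falsum := rfl

/-- `toFormula` of `⊥`. [folklore] -/
theorem toFormula_bot : (⊥ : L.BoundedFormula α n).toFormula = ⊥ := rfl

/-- `toFormula` of a universal quantification. [folklore] -/
theorem toFormula_all (φ : L.BoundedFormula α (n + 1)) :
    φ.all.toFormula = (BoundedFormula.relabel (toFormulaAux α n) φ.toFormula).all := rfl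

/-- `toFormula` of an atomic relation. [folklore] -/
theorem toFormula_rel {l : ℕ} (R : L.Relations l) (ts : Fin l → L.Term (α ⊕ Fin n)) :
    (rel R ts : L.BoundedFormula α n).toFormula =
      rel R fun i => (ts i).relabel (Sum.inl : α ⊕ Fin n → (α ⊕ Fin n) ⊕ Fin 0) := rfl

/-- The variable map of `toFormula` under a binder sends the last bound variable to the new bound
variable. [folklore] -/
theorem relabelAux_toFormulaAux_inl_inr_last :
    relabelAux (toFormulaAux α n) 0 (Sum.inl (Sum.inr (Fin.last n))) = Sum.inr (Fin.last 0) := by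
  simp only [relabelAux, toFormulaAux, Function.comp_apply, Sum.map_inl, Sum.elim_inr,
    finSumFinEquiv_symm_last, Sum.map_inr, id_eq, Equiv.sumAssoc_apply_inl_inr]
  rfl

/-- The variable map of `toFormula` under a binder, on the weakened outer variables. [folklore] -/
theorem relabelAux_toFormulaAux_comp :
    (relabelAux (toFormulaAux α n) 0 ∘ (Sum.inl : α ⊕ Fin (n + 1) → (α ⊕ Fin (n + 1)) ⊕ Fin 0) ∘
        Sum.map id Fin.castSucc) =
      (Sum.map id Fin.castSucc ∘ (Sum.inl : α ⊕ Fin n → (α ⊕ Fin n) ⊕ Fin 0)) := by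
  funext x
  rcases x with a | j
  · simp [relabelAux, toFormulaAux]
  · simp [relabelAux, toFormulaAux, finSumFinEquiv_symm_apply_castSucc]

variable [L.IsOrdered]

/-- `toFormula` of an atomic inequality under the binder relabelling of a bounded quantifier.
[folklore] -/
theorem relabel_toFormula_le_last (t : L.Term (α ⊕ Fin n)) :
    BoundedFormula.relabel (toFormulaAux α n) ((Term.le (&(Fin.last n))
      (t.relabel (Sum.map id Fin.castSucc)) : L.BoundedFormula α (n + 1)).toFormula) =
      Term.le (&(Fin.last 0)) ((t.relabel (Sum.inl : α ⊕ Fin n → (α ⊕ Fin n) ⊕ Fin 0)).relabel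
        (Sum.map id Fin.castSucc)) := by
  simp only [Term.le, Relations.boundedFormula₂, Relations.boundedFormula, toFormula_rel]
  rw [BoundedFormula.relabel]
  simp only [mapTermRel, id_eq]
  congr 1
  funext i
  fin_cases i
  · simp only [Fin.zero_eta, Matrix.cons_val_zero, Term.relabel, Function.comp_apply,
      relabelAux_toFormulaAux_inl_inr_last]
  · simp only [Fin.mk_one, Matrix.cons_val_one, Matrix.cons_val_zero, Term.relabel_relabel,
      Function.comp_apply]
    rw [relabelAux_toFormulaAux_comp]

/-- **`toFormula` commutes with the bounded universal quantifier.** [folklore] -/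
theorem toFormula_ballLE (t : L.Term (α ⊕ Fin n)) (φ : L.BoundedFormula α (n + 1)) :
    (ballLE t φ).toFormula =
      ballLE (t.relabel (Sum.inl : α ⊕ Fin n → (α ⊕ Fin n) ⊕ Fin 0))
        (BoundedFormula.relabel (toFormulaAux α n) φ.toFormula) := by
  rw [ballLE, toFormula_all, toFormula_imp, relabel_imp, relabel_toFormula_le_last]
  rfl

/-- **`toFormula` commutes with the bounded existential quantifier.** [folklore] -/
theorem toFormula_bexLE (t : L.Term (α ⊕ Fin n)) (φ : L.BoundedFormula α (n + 1)) :
    (bexLE t φ).toFormula =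
      bexLE (t.relabel (Sum.inl : α ⊕ Fin n → (α ⊕ Fin n) ⊕ Fin 0))
        (BoundedFormula.relabel (toFormulaAux α n) φ.toFormula) := by
  simp only [bexLE, BoundedFormula.ex, BoundedFormula.not, min, toFormula_imp, toFormula_all,
    toFormula_bot, relabel_imp, relabel_bot, relabel_toFormula_le_last]

end General

/-! ## The language of bounded arithmetic -/

section BoundedArith

variable {α : Type} {n : ℕ}

/-- Relabelling commutes with the length term former (local copy; `|·|`). [folklore] -/
private theorem relabel_len' {γ δ : Type} (r : γ → δ) (t : Language.boundedArith.Term γ) :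
    (Term.len t).relabel r = Term.len (t.relabel r) := by
  simp only [Term.len, Functions.apply₁, Term.relabel]
  congr 1
  funext j
  fin_cases j
  rfl

/-- `toFormula` commutes with the sharply bounded universal quantifier. [folklore] -/
theorem toFormula_ballLELen (t : Language.boundedArith.Term (α ⊕ Fin n))
    (φ : Language.boundedArith.BoundedFormula α (n + 1)) :
    (ballLELen t φ).toFormula =
      ballLELen (t.relabel (Sum.inl : α ⊕ Fin n → (α ⊕ Fin n) ⊕ Fin 0))
        (BoundedFormula.relabel (toFormulaAux α n) φ.toFormula) := by
  simp only [ballLELen, toFormula_ballLE, relabel_len']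

/-- `toFormula` commutes with the sharply bounded existential quantifier. [folklore] -/
theorem toFormula_bexLELen (t : Language.boundedArith.Term (α ⊕ Fin n))
    (φ : Language.boundedArith.BoundedFormula α (n + 1)) :
    (bexLELen t φ).toFormula =
      bexLELen (t.relabel (Sum.inl : α ⊕ Fin n → (α ⊕ Fin n) ⊕ Fin 0))
        (BoundedFormula.relabel (toFormulaAux α n) φ.toFormula) := by
  simp only [bexLELen, toFormula_bexLE, relabel_len']

/-- **Sharply bounded formulas are stable under `toFormula`** (Buss 1986, §2.1). [cite: Buss1986, §2.1] -/
theorem IsSharplyBounded.toFormula {φ : Language.boundedArith.BoundedFormula α n}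
    (h : IsSharplyBounded φ) : IsSharplyBounded φ.toFormula := by
  induction h with
  | of_isQF h => exact .of_isQF h.toFormula
  | imp _ _ ih₁ ih₂ => rw [toFormula_imp]; exact .imp ih₁ ih₂
  | ballLELen t _ ih => rw [toFormula_ballLELen]; exact .ballLELen _ (ih.relabel _)
  | bexLELen t _ ih => rw [toFormula_bexLELen]; exact .bexLELen _ (ih.relabel _)

/-- **`Σᵇᵢ` and `Πᵇᵢ` are stable under `toFormula`** (Buss 1986, §2.1; simultaneous induction,
using the stability under relabelling of `BoundedArithRelabel`). [cite: Buss1986, §2.1] -/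
theorem IsSigmab.toFormula_and_IsPib_toFormula (i : ℕ) :
    (∀ {n : ℕ} {φ : Language.boundedArith.BoundedFormula α n}, IsSigmab i φ →
      IsSigmab i φ.toFormula) ∧
    (∀ {n : ℕ} {φ : Language.boundedArith.BoundedFormula α n}, IsPib i φ →
      IsPib i φ.toFormula) := by
  constructor
  · intro n φ h
    refine IsSigmab.rec
      (motive_1 := fun i n φ _ => IsSigmab i φ.toFormula)
      (motive_2 := fun i n φ _ => IsPib i φ.toFormula)
      ?_ ?_ ?_ ?_ ?_ ?_ ?_ ?_ ?_ ?_ h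
    · exact fun h => .of_isSharplyBounded h.toFormula
    · exact fun _ ih => .of_isPib ih
    · intro i n φ ψ _ _ ih₁ ih₂
      rw [toFormula_imp]; exact .imp ih₁ ih₂
    · intro i n t φ _ ih
      rw [toFormula_bexLE]; exact .bexLE _ (ih.relabel _)
    · intro i n t φ _ ih
      rw [toFormula_ballLELen]; exact .ballLELen _ (ih.relabel _)
    · exact fun h => .of_isSharplyBounded h.toFormula
    · exact fun _ ih => .of_isSigmab ih
    · intro i n φ ψ _ _ ih₁ ih₂
      rw [toFormula_imp]; exact .imp ih₁ ih₂
    · intro i n t φ _ ih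
      rw [toFormula_ballLE]; exact .ballLE _ (ih.relabel _)
    · intro i n t φ _ ih
      rw [toFormula_bexLELen]; exact .bexLELen _ (ih.relabel _)
  · intro n φ h
    refine IsPib.rec
      (motive_1 := fun i n φ _ => IsSigmab i φ.toFormula)
      (motive_2 := fun i n φ _ => IsPib i φ.toFormula)
      ?_ ?_ ?_ ?_ ?_ ?_ ?_ ?_ ?_ ?_ h
    · exact fun h => .of_isSharplyBounded h.toFormula
    · exact fun _ ih => .of_isPib ih
    · intro i n φ ψ _ _ ih₁ ih₂
      rw [toFormula_imp]; exact .imp ih₁ ih₂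
    · intro i n t φ _ ih
      rw [toFormula_bexLE]; exact .bexLE _ (ih.relabel _)
    · intro i n t φ _ ih
      rw [toFormula_ballLELen]; exact .ballLELen _ (ih.relabel _)
    · exact fun h => .of_isSharplyBounded h.toFormula
    · exact fun _ ih => .of_isSigmab ih
    · intro i n φ ψ _ _ ih₁ ih₂
      rw [toFormula_imp]; exact .imp ih₁ ih₂
    · intro i n t φ _ ih
      rw [toFormula_ballLE]; exact .ballLE _ (ih.relabel _)
    · intro i n t φ _ ih
      rw [toFormula_bexLELen]; exact .bexLELen _ (ih.relabel _)

/-- `Σᵇᵢ` is stable under `toFormula` (Buss 1986, §2.1). [cite: Buss1986, §2.1] -/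
theorem IsSigmab.toFormula {i : ℕ} {φ : Language.boundedArith.BoundedFormula α n}
    (h : IsSigmab i φ) : IsSigmab i φ.toFormula :=
  (IsSigmab.toFormula_and_IsPib_toFormula i).1 h

/-- `Πᵇᵢ` is stable under `toFormula` (Buss 1986, §2.1). [cite: Buss1986, §2.1] -/
theorem IsPib.toFormula {i : ℕ} {φ : Language.boundedArith.BoundedFormula α n}
    (h : IsPib i φ) : IsPib i φ.toFormula :=
  (IsSigmab.toFormula_and_IsPib_toFormula i).2 h

end BoundedArith

/-! ## Bounded formulas as definable predicates of a structure -/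

section Definable

variable {M : Type} [Language.boundedArith.Structure M] {n i : ℕ}

/-- The parameter-free formula with free variables `Fin n` realized as a formula with parameters
`M ⊕ Fin n` (no parameter occurs). [folklore] -/
def liftParams (θ : Language.boundedArith.BoundedFormula Empty n) :
    Language.boundedArith.Formula (M ⊕ Fin n) :=
  θ.toFormula.relabel (Sum.elim Empty.elim Sum.inr)

/-- Semantics of `liftParams`: the realization at the arguments. [folklore] -/
theorem realize_liftParams (θ : Language.boundedArith.BoundedFormula Empty n) (xs : Fin n → M) :
    (liftParams θ : Language.boundedArith.Formula (M ⊕ Fin n)).Realize (argEnv xs) ↔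
      θ.Realize default xs := by
  rw [liftParams, Formula.realize_relabel, realize_toFormula]
  have e1 : (argEnv xs ∘ Sum.elim Empty.elim Sum.inr) ∘ Sum.inl = (default : Empty → M) :=
    Subsingleton.elim _ _
  have e2 : (argEnv xs ∘ Sum.elim Empty.elim Sum.inr) ∘ Sum.inr = xs := by
    funext j; rfl
  rw [e1, e2]

/-- **A `Σᵇᵢ` formula (in-context variables `Fin n`, no parameters) defines a `Σᵇᵢ`-definable
predicate** of any structure. [cite: Buss1986, §2.1] -/
theorem IsSigmab.isSigmabDef_realize {θ : Language.boundedArith.BoundedFormula Empty n}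
    (h : IsSigmab i θ) : IsSigmabDef i fun xs : Fin n → M => θ.Realize default xs :=
  ⟨liftParams θ, (h.toFormula).formulaRelabel _, fun xs => (realize_liftParams θ xs).symm⟩

/-- **A `Πᵇᵢ` formula (in-context variables `Fin n`, no parameters) defines a `Πᵇᵢ`-definable
predicate** of any structure. [cite: Buss1986, §2.1] -/
theorem IsPib.isPibDef_realize {θ : Language.boundedArith.BoundedFormula Empty n}
    (h : IsPib i θ) : IsPibDef i fun xs : Fin n → M => θ.Realize default xs :=
  ⟨liftParams θ, (h.toFormula).formulaRelabel _, fun xs => (realize_liftParams θ xs).symm⟩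

/-- A term with variables `Empty ⊕ Fin n` defines a term function of any structure. [folklore] -/
theorem isTermFn_realize (t : Language.boundedArith.Term (Empty ⊕ Fin n)) :
    IsTermFn fun xs : Fin n → M => t.realize (Sum.elim default xs) := by
  refine ⟨t.relabel (Sum.elim Empty.elim Sum.inr), fun xs => ?_⟩
  rw [Term.realize_relabel]
  show t.realize (Sum.elim default xs) = t.realize (argEnv xs ∘ Sum.elim Empty.elim Sum.inr)
  congr 1
  funext x
  rcases x with e | j
  · exact e.elim
  · rfl

end Definable

end Literature.Computability.MetaComplexity
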